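import Literature.Geometry.GeometricMeasureTheory.DilationInvariance
import HarnessLib

/-!
# Currents of integration under the dilations `y ↦ b + r • y`: the push-forward formula and mass

For a current of integration `[W, θ, ξ]` on `Ω₂` (`Currents.lean`) and the dilation
`A y = b + r • y` (`r > 0`) with `A(Ω₁) ⊆ Ω₂`, the current
`[A⁻¹W ∩ Ω₁, θ ∘ A, ξ ∘ A]` on `Ω₁` — the shape of the blow-up `(μ_{1/r} ∘ τ_{-b})_# [W, θ, ξ]`
of [Federer1969, 4.3.16], cf. `HolomorphicChain.blowUp` — satisfies

* `currentOfIntegration_preimage_add_smul_apply` — **the push-forward formula**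
  `[A⁻¹W ∩ Ω₁, θ ∘ A, ξ ∘ A](φ) = r⁻ᵐ · [W, θ, ξ](ψ)` whenever `φ = ψ ∘ A`
  (change of variables `A_#(𝓗^m ⌞ A⁻¹W) = r⁻ᵐ 𝓗^m ⌞ W` of `DilationInvariance.lean`), for locally
  summable data;
* `exists_testFunction_comp_add_smul` — every test form `φ` on `Ω₁` is `ψ ∘ A` for the test form
  `ψ = φ ∘ A⁻¹` on `Ω₂`;
* `mass_currentOfIntegration_preimage_add_smul_le` — hence Harvey's
  **`𝐌_{B(0,1)}((1/r)_* T) ≤ r⁻ᵐ 𝐌_{B(b,r)}(T)`** [Harvey1977, §1.10] in the form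
  `𝐌([A⁻¹W ∩ Ω₁, θ ∘ A, ξ ∘ A]) ≤ r⁻ᵐ · 𝐌([W, θ, ξ] on Ω₂)`.

* `extDeriv_comp_add_smul`, `boundary_currentOfIntegration_preimage_add_smul_apply`,
  `boundary_currentOfIntegration_preimage_add_smul_eq_zero` — `d(ω ∘ A) = r • (dω) ∘ A`, hence
  `∂[A⁻¹W ∩ Ω₁, θ ∘ A, ξ ∘ A](ω ∘ A) = r⁻ᵐ ∂[W, θ, ξ](ω)` in dimension `m + 1`, and
  **blow-ups of cycles are cycles** [Federer1969, 4.1.14: `∂ f_# = f_# ∂`].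

No definitions, no named facts.

## References

* H. Federer, *Geometric Measure Theory*, Springer 1969, 4.1.7, 4.3.16 [Federer1969].
* R. Harvey, *Holomorphic chains and their boundaries*, PSPUM XXX.1 (1977), §1.10 [Harvey1977].
-/

open scoped Distributions ENNReal NNReal Topology Pointwise
open MeasureTheory MeasureTheory.Measure TopologicalSpace Set Filter Metric

namespace Literature.Geometry.GeometricMeasureTheory

-- Nested operator-norm instances on (duals of) `E [⋀^Fin m]→L[ℝ] ℝ`, as in `Currents.lean`.
set_option maxSynthPendingDepth 2

variable {V : Type*} [NormedAddCommGroup V] [NormedSpace ℝ V]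

/-! ### Dilated test functions -/

section TestFunctions

variable {F : Type*} [NormedAddCommGroup F] [NormedSpace ℝ F] {Ω₁ Ω₂ : Opens V} {n : ℕ∞}

/-- **Dilating a test function.** If `A(Ω₁) ⊆ Ω₂` for the dilation `A y = b + r • y` (`r ≠ 0`),
every test function `φ` on `Ω₁` is `ψ ∘ A` for the test function `ψ = φ ∘ A⁻¹`,
`ψ x = φ(r⁻¹ • (x - b))`, on `Ω₂` (smooth, with compact support `A(spt φ) ⊆ Ω₂`). This is the
pull-back `(A⁻¹)^# φ` up to the factor `r⁻ᵐ` on `m`-vectors. [cite: Federer1969, 4.1.7] -/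
theorem exists_testFunction_comp_add_smul (b : V) {r : ℝ} (hr : r ≠ 0)
    (hA : (fun y : V => b + r • y) '' (Ω₁ : Set V) ⊆ Ω₂) (φ : 𝓓^{n}(Ω₁, F)) :
    ∃ ψ : 𝓓^{n}(Ω₂, F), ∀ x, ψ x = φ (r⁻¹ • (x - b)) := by
  let e : V ≃ₜ V := (Homeomorph.smulOfNeZero r hr).trans (Homeomorph.addLeft b)
  have he : ∀ y, e y = b + r • y := fun y => rfl
  have hes : ∀ x, e.symm x = r⁻¹ • (x - b) := by
    intro x
    apply e.injective
    rw [e.apply_symm_apply, he, smul_smul, mul_inv_cancel₀ hr, one_smul, add_sub_cancel]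
  have hfun : (fun x => φ (r⁻¹ • (x - b))) = φ ∘ e.symm := funext fun x => by
    rw [Function.comp_apply, hes]
  refine ⟨⟨fun x => φ (r⁻¹ • (x - b)), ?_, ?_, ?_⟩, fun x => rfl⟩
  · exact φ.contDiff.comp ((contDiff_id.sub contDiff_const).const_smul r⁻¹)
  · rw [hfun]
    exact φ.hasCompactSupport.comp_homeomorph e.symm
  · rw [hfun, tsupport, Function.support_comp_eq_preimage, ← e.image_eq_preimage_symm,
      ← e.image_closure]
    refine Set.Subset.trans (Set.image_mono φ.tsupport_subset) ?_
    rintro _ ⟨y, hy, rfl⟩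
    exact hA ⟨y, hy, (he y).symm⟩

end TestFunctions

/-! ### The push-forward formula and the mass bound -/

section Integration

variable [MeasurableSpace V] [BorelSpace V] {Ω₁ Ω₂ : Opens V} {m : ℕ}

/-- **Push-forward formula for currents of integration under dilations.** For locally summable
data `[W, θ, ξ]` on `Ω₂`, the dilation `A y = b + r • y` (`r > 0`) with `A(Ω₁) ⊆ Ω₂`, and test
forms `φ` on `Ω₁`, `ψ` on `Ω₂` with `φ = ψ ∘ A`:
`[A⁻¹W ∩ Ω₁, θ ∘ A, ξ ∘ A](φ) = r⁻ᵐ · [W, θ, ξ](ψ)`, i.e.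
`∫_{A⁻¹W} θ(Ay) ψ(Ay)(ξ(Ay)) d𝓗^m(y) = r⁻ᵐ ∫_W θ ψ(ξ) d𝓗^m` (change of variables
`A_#(𝓗^m ⌞ A⁻¹W) = r⁻ᵐ 𝓗^m ⌞ W`). [cite: Federer1969, 4.3.16] -/
theorem currentOfIntegration_preimage_add_smul_apply {W : Set V} (hW : MeasurableSet W)
    (θ : V → ℤ) (ξ : V → Fin m → V) (b : V) {r : ℝ} (hr : 0 < r)
    (hA : (fun y : V => b + r • y) '' (Ω₁ : Set V) ⊆ Ω₂)
    (hint : LocallyIntegrableOn (fun x => (θ x : ℝ) • frameVector (ξ x)) (Ω₂ : Set V)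
      ((μHE[m] : Measure V).restrict W))
    (φ : TestForm Ω₁ m) (ψ : TestForm Ω₂ m) (hφψ : ∀ y, φ y = ψ (b + r • y)) :
    (currentOfIntegration ((fun y : V => b + r • y) ⁻¹' W ∩ (Ω₁ : Set V))
        (fun y => θ (b + r • y)) (fun y => ξ (b + r • y)) : Current Ω₁ m) φ =
      r⁻¹ ^ m * (currentOfIntegration W θ ξ : Current Ω₂ m) ψ := by
  have hmeas : Measurable (fun y : V => b + r • y) := (measurable_const_smul r).const_add b
  have hmeasW' : MeasurableSet ((fun y : V => b + r • y) ⁻¹' W) := hW.preimage hmeas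
  -- local summability of the dilated data on `Ω₁`
  have hintA : LocallyIntegrableOn
      (fun y => ((θ (b + r • y) : ℤ) : ℝ) • frameVector (ξ (b + r • y))) (Ω₁ : Set V)
      ((μHE[m] : Measure V).restrict ((fun y : V => b + r • y) ⁻¹' W ∩ (Ω₁ : Set V))) := by
    have h := locallyIntegrableOn_comp_add_smul (m := m)
      (η := fun x => (θ x : ℝ) • frameVector (ξ x)) hW b hr hA hint
    intro y hy
    obtain ⟨u, hu, hu'⟩ := h y hy
    exact ⟨u, hu, hu'.mono_measure (Measure.restrict_mono Set.inter_subset_left le_rfl)⟩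
  rw [currentOfIntegration_apply hintA, currentOfIntegration_apply hint]
  -- Step 1: the integrand vanishes off `Ω₁`, so integrate over `A⁻¹W`
  have step1 : ∫ y in (fun y : V => b + r • y) ⁻¹' W ∩ (Ω₁ : Set V),
      ((θ (b + r • y) : ℤ) : ℝ) * φ y (ξ (b + r • y)) ∂(μHE[m] : Measure V) =
      ∫ y in (fun y : V => b + r • y) ⁻¹' W,
        ((θ (b + r • y) : ℤ) : ℝ) * φ y (ξ (b + r • y)) ∂(μHE[m] : Measure V) := by
    refine (setIntegral_eq_of_subset_of_forall_sdiff_eq_zero hmeasW' Set.inter_subset_left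
      fun y hy => ?_).symm
    have hy' : y ∉ tsupport ⇑φ := fun h => hy.2 ⟨hy.1, φ.tsupport_subset h⟩
    rw [image_eq_zero_of_notMem_tsupport hy', ContinuousAlternatingMap.coe_zero, Pi.zero_apply, mul_zero]
  -- Step 2: change of variables under `A`
  let eA : V ≃ᵐ V :=
    ((Homeomorph.smulOfNeZero r hr.ne').trans (Homeomorph.addLeft b)).toMeasurableEquiv
  have heA : ⇑eA = fun y : V => b + r • y := rfl
  have step2 : ∫ y in (fun y : V => b + r • y) ⁻¹' W,
      ((θ (b + r • y) : ℤ) : ℝ) * φ y (ξ (b + r • y)) ∂(μHE[m] : Measure V) =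
      ∫ x, (θ x : ℝ) * ψ x (ξ x) ∂(Measure.map eA
        ((μHE[m] : Measure V).restrict ((fun y : V => b + r • y) ⁻¹' W))) := by
    rw [integral_map_equiv eA]
    refine integral_congr_ae (Eventually.of_forall fun y => ?_)
    simp only [heA, hφψ y]
  rw [step1, step2, heA, map_add_smul_restrict_preimage b hr W, integral_smul_measure,
    ENNReal.toReal_ofReal (pow_nonneg (inv_nonneg.2 hr.le) _), smul_eq_mul]

/-- **`𝐌((1/r)_* T) ≤ r⁻ᵐ · 𝐌(T)` for currents of integration** ("𝐌_{B(0,1)}((1/r)_*(T)) =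
(1/rᵖ) 𝐌_{B(0,r)}(T)", Harvey): with `A y = b + r • y`, `r > 0`, `A(Ω₁) ⊆ Ω₂` and locally
summable data, `𝐌([A⁻¹W ∩ Ω₁, θ ∘ A, ξ ∘ A]) ≤ r⁻ᵐ · 𝐌([W, θ, ξ])`, the masses being those
of currents on `Ω₁` and on `Ω₂`: every test form `φ` on `Ω₁` of comass `≤ 1` is `ψ ∘ A` with
`ψ = φ ∘ A⁻¹` of comass `≤ 1` on `Ω₂`. [cite: Harvey1977, §1.10] -/
theorem mass_currentOfIntegration_preimage_add_smul_le {W : Set V} (hW : MeasurableSet W)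
    (θ : V → ℤ) (ξ : V → Fin m → V) (b : V) {r : ℝ} (hr : 0 < r)
    (hA : (fun y : V => b + r • y) '' (Ω₁ : Set V) ⊆ Ω₂)
    (hint : LocallyIntegrableOn (fun x => (θ x : ℝ) • frameVector (ξ x)) (Ω₂ : Set V)
      ((μHE[m] : Measure V).restrict W)) :
    (currentOfIntegration ((fun y : V => b + r • y) ⁻¹' W ∩ (Ω₁ : Set V))
        (fun y => θ (b + r • y)) (fun y => ξ (b + r • y)) : Current Ω₁ m).mass ≤
      ENNReal.ofReal (r⁻¹ ^ m) * (currentOfIntegration W θ ξ : Current Ω₂ m).mass := by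
  refine iSup₂_le fun φ hφ => ?_
  obtain ⟨ψ, hψ⟩ := exists_testFunction_comp_add_smul b hr.ne' hA φ
  have hφψ : ∀ y, φ y = ψ (b + r • y) := fun y => by
    rw [hψ, add_sub_cancel_left, smul_smul, inv_mul_cancel₀ hr.ne', one_smul]
  rw [currentOfIntegration_preimage_add_smul_apply hW θ ξ b hr hA hint φ ψ hφψ,
    ENNReal.ofReal_mul (pow_nonneg (inv_nonneg.2 hr.le) _)]
  gcongr
  exact Current.ofReal_apply_le_mass _ fun x => by rw [hψ]; exact hφ _

end Integration

/-! ### Boundaries of dilated currents of integration -/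

section Boundary

variable {F : Type*} [NormedAddCommGroup F] [NormedSpace ℝ F] {k : ℕ}

omit [NormedSpace ℝ V] in
/-- **Chain rule for `d` under dilations**: `d(ω ∘ A)(y) = r • (dω)(A y)` for `A y = b + r • y`
(the derivative of `A` is `r • id`, and `d` is linear in the derivative). [folklore] -/
theorem extDeriv_comp_add_smul [NormedSpace ℝ V] (ω : V → V [⋀^Fin k]→L[ℝ] F)
    (hω : Differentiable ℝ ω) (b : V) (r : ℝ) (y : V) :
    extDeriv (fun y : V => ω (b + r • y)) y = r • extDeriv ω (b + r • y) := by
  have hA : HasFDerivAt (fun y : V => b + r • y) (r • ContinuousLinearMap.id ℝ V) y :=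
    ((hasFDerivAt_id y).const_smul r).const_add b
  have hcomp : fderiv ℝ (fun y : V => ω (b + r • y)) y = r • fderiv ℝ ω (b + r • y) := by
    rw [show (fun y : V => ω (b + r • y)) = ω ∘ fun y : V => b + r • y from rfl,
      fderiv_comp y (hω _) hA.differentiableAt, hA.fderiv, ContinuousLinearMap.comp_smul,
      ContinuousLinearMap.comp_id]
  rw [extDeriv, extDeriv, hcomp, ContinuousAlternatingMap.alternatizeUncurryFin_smul]

end Boundary

section BoundaryIntegration

variable [MeasurableSpace V] [BorelSpace V] {Ω₁ Ω₂ : Opens V} {m : ℕ}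

/-- **Boundary of the dilated current of integration**: with `A y = b + r • y` (`r > 0`),
`A(Ω₁) ⊆ Ω₂`, locally summable data `[W, θ, ξ]` of dimension `m + 1` on `Ω₂`, and test `m`-forms
`χ = ω ∘ A`: `∂[A⁻¹W ∩ Ω₁, θ ∘ A, ξ ∘ A](χ) = r⁻ᵐ · ∂[W, θ, ξ](ω)` — since `dχ = (r • dω) ∘ A` and
the push-forward formula loses `r^{-(m+1)}` (`∂` commutes with `f_#`, [Federer1969, 4.1.7, 4.1.14]).
[cite: Federer1969, 4.1.14] -/
theorem boundary_currentOfIntegration_preimage_add_smul_apply {W : Set V} (hW : MeasurableSet W)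
    (θ : V → ℤ) (ξ : V → Fin (m + 1) → V) (b : V) {r : ℝ} (hr : 0 < r)
    (hA : (fun y : V => b + r • y) '' (Ω₁ : Set V) ⊆ Ω₂)
    (hint : LocallyIntegrableOn (fun x => (θ x : ℝ) • frameVector (ξ x)) (Ω₂ : Set V)
      ((μHE[m + 1] : Measure V).restrict W))
    (χ : TestForm Ω₁ m) (ω : TestForm Ω₂ m) (hχω : ∀ y, χ y = ω (b + r • y)) :
    (currentOfIntegration ((fun y : V => b + r • y) ⁻¹' W ∩ (Ω₁ : Set V))
        (fun y => θ (b + r • y)) (fun y => ξ (b + r • y)) : Current Ω₁ (m + 1)).boundary χ =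
      r⁻¹ ^ m * (currentOfIntegration W θ ξ : Current Ω₂ (m + 1)).boundary ω := by
  have hd : ∀ y, TestForm.extDerivCLM χ y = (r • TestForm.extDerivCLM ω) (b + r • y) := by
    intro y
    rw [TestForm.extDerivCLM_apply, FunLike.coe_smul, Pi.smul_apply, TestForm.extDerivCLM_apply,
      show (⇑χ : V → Covector V m) = fun y => ω (b + r • y) from funext hχω]
    exact extDeriv_comp_add_smul _ (ω.contDiff.differentiable (by simp)) b r y
  rw [Current.boundary_apply, Current.boundary_apply,
    currentOfIntegration_preimage_add_smul_apply hW θ ξ b hr hA hint _ _ hd, map_smul,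
    smul_eq_mul, ← mul_assoc, pow_succ, mul_assoc (r⁻¹ ^ m), inv_mul_cancel₀ hr.ne', mul_one]

/-- **Blow-ups of cycles are cycles**: if `∂[W, θ, ξ] = 0` on `Ω₂` then
`∂[A⁻¹W ∩ Ω₁, θ ∘ A, ξ ∘ A] = 0` on `Ω₁` (`A y = b + r • y`, `r > 0`, `A(Ω₁) ⊆ Ω₂`, locally
summable data). [cite: Federer1969, 4.1.14] -/
theorem boundary_currentOfIntegration_preimage_add_smul_eq_zero {W : Set V}
    (hW : MeasurableSet W) (θ : V → ℤ) (ξ : V → Fin (m + 1) → V) (b : V) {r : ℝ} (hr : 0 < r)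
    (hA : (fun y : V => b + r • y) '' (Ω₁ : Set V) ⊆ Ω₂)
    (hint : LocallyIntegrableOn (fun x => (θ x : ℝ) • frameVector (ξ x)) (Ω₂ : Set V)
      ((μHE[m + 1] : Measure V).restrict W))
    (h0 : (currentOfIntegration W θ ξ : Current Ω₂ (m + 1)).boundary = 0) :
    (currentOfIntegration ((fun y : V => b + r • y) ⁻¹' W ∩ (Ω₁ : Set V))
        (fun y => θ (b + r • y)) (fun y => ξ (b + r • y)) : Current Ω₁ (m + 1)).boundary = 0 := by
  ext χ
  obtain ⟨ω, hω⟩ := exists_testFunction_comp_add_smul b hr.ne' hA χ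
  have hχω : ∀ y, χ y = ω (b + r • y) := fun y => by
    rw [hω, add_sub_cancel_left, smul_smul, inv_mul_cancel₀ hr.ne', one_smul]
  rw [boundary_currentOfIntegration_preimage_add_smul_apply hW θ ξ b hr hA hint χ ω hχω, h0,
    zero_apply, zero_apply, mul_zero]

end BoundaryIntegration

end Literature.Geometry.GeometricMeasureTheory
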